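import Summits.BirchSwinnertonDyer.BirchSwinnertonDyer.Theorems.PrintCFramBottomClassIndexLawFiveLeBorelTypeTwoCebotarev
import Summits.BirchSwinnertonDyer.BirchSwinnertonDyer.Theorems.PrintCFramBottomClassIndexLawFiveLeBorelTypeTwoCongruences
import Summits.BirchSwinnertonDyer.BirchSwinnertonDyer.Theorems.PrintCFramBottomClassIndexLawFiveLeBorelDepthEigenTargets
import Summits.BirchSwinnertonDyer.BirchSwinnertonDyer.Theorems.PrintCFramBottomClassIndexLawFiveLeBorelGrossSurjectivityTowerLeaf
import HarnessLib

/-!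
# Route `PrintCFram`, crux C2 `BottomClassIndexLawFiveLe` (stmt-BirchSwinnertonDyer-20372), road II
# (`borel_heegner_squeeze` S2 `stub_kolyvaginUpper_borelCM`): **FILE 7″ — THE BOREL ČEBOTAREV REQUESTS
# AT A KOLYVAGIN PRIME OF THE SECOND FROBENIUS TYPE, with FILE 7′'s sign rule SWAPPED**
# (cell `bsd-print-cfram`, width seat `bsd-line-cfram-p1-w5` g12; helper `--supports` 20372;
# 0 facts, 0 defs, 0 sorry)

HONEST FRAMING. Nothing about BSD is proved here, and nothing of the stub itself. FILE 7′
(`…BorelRequestsCebotarev.exists_kolyvaginPrime_gt_pow_requests_of_cmRamified`, w2 g7) prescribes local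
orders `p^{N_i}` at a Kolyvagin prime of Gross's type (3.2) (`Frob(ℓ) = Frob(∞)` on `K(W[p^M])`) for a
top-independent family of `c_*`-eigenclasses on the Borel CM leaf, under the rule «sign `η`: any order
`≤ ord = p^{⌈e/2⌉}` (`2N ≤ e + 1`); sign `−η`: orders `≤ p^{⌊e/2⌋}` (`2N ≤ e`)» — the rule that makes a
depth-one `(−η)`-class BLIND and costs the order telescope one `p` per step (w2 g8). This file proves the
SAME request theorem at a prime of the SECOND Frobenius type (Frobenius `∼ c₀·z`, `z ∈ Γ_K` acting on
`W[p^M]` as `−1`; companions `…BorelTypeTwoCebotarev`, `…BorelTypeTwoCongruences`,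
`…BorelTypeTwoVisibility`) with the rule **SWAPPED: sign `−η`: any order `≤ ord` (`2N ≤ e + 1`);
sign `η`: orders `≤ p^{⌊e/2⌋}` (`2N ≤ e`)**:

* `torsionMap_h1Eval_conjGalCMH_mul_of_smul_eq_neg` — the offset `[x, z^τz]` of a `ν`-class is
  `(−ν)`-eigen for the lift `τ`;
* **`exists_prime_gt_pow_requests_typeTwo_of_cmRamified`** — same data as FILE 7′ plus `z`; conclusion:
  above every `b` a prime `ℓ ∤ N·d_K`, `ℓ ≠ p`, `(ℓ)` prime in `𝓞 K`, `p^M ∣ ℓ + 1`, `p^M ∣ a_ℓ` (good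
  reduction), Frobenius `= −c₀` on `W(ℚ̄)[p^M]` and `= c₀` on `K`, and `p^{N_i} x_i ∈ ker loc_λ`,
  `N_i ≠ 0 → p^{N_i−1} x_i ∉ ker loc_λ` for every `i` (the shape of
  `KolyvaginDescent.HypothesesM.cebotarev`, without `FrobEqFrobInfty`). Mechanism: at a type-two prime the
  achievable local values of `x_i` are `[x_i, z^τz] + (1 − ν_iτ)[x_i, ρ₀]`, i.e. the whole
  `(−ν_i)`-eigenspace of the value layer `W[𝔭^{e_i}]` (exponent `p^{⌈e/2⌉}` for `−ν_i = η`,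
  `p^{⌊e/2⌋}` for `−ν_i = −η`); pick `(−ν_i)`-eigen `u_i` of exact depth (`exists_eigen_exactDepth`),
  realise `t_i = ½(u_i − [x_i, z^τz])` jointly (`exists_h1Eval_eq_pow_of_cmRamified`, McCallum's (2) on
  the leaf — arbitrary targets in the layers), run the type-two Čebotarev step with `ρ = zρ₀`.

So, with the type CHOSEN PER STEP, a descent step loses its `p` only when it must see an odd-depth
`η`-class AND an odd-depth `(−η)`-class at the same prime (crux notes
`Lines/eisenstein-resource-bdp-line-w5g12-type2.md` §3). The existence of `z` is a hypothesis (on the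
class: every proper quadratic twist `A(p)^{(e)}` with `K(√d_K) ≠ ℚ(√−p, √e)`; never the untwisted
`A(p)`). THEOREMS ONLY; no definition, no named fact, no `sorry`; conditional on `chebotarev_artinRep`
as FILE 1/6/7/7′. BSD is not proved by any of this; no summit statement is proved by this seat; UPPER is
not claimed. Reference: [McCallumLMS1991] §3 Cor. 3.2 with (2), (3); §4.
-/

set_option autoImplicit false
-- `…BirchSwinnertonDyer.BirchSwinnertonDyer.Theorems…` is the problem's mandated namespace (D-0017).
set_option linter.dupNamespace false

noncomputable section

open scoped Classical Pointwise

namespace Summit.BirchSwinnertonDyer.BirchSwinnertonDyer.Theorems.PrintCFram.BorelTypeTwo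

open WeierstrassCurve NumberField IsDedekindDomain Field Literature.NumberTheory.EllipticCurves
  Literature.NumberTheory.GaloisRepresentations

universe u v

/-! ## §6 FILE 7″: the Borel Čebotarev REQUESTS at a type-two prime — the sign rule SWAPPED -/

section Requests

open Summit.BirchSwinnertonDyer.BirchSwinnertonDyer.Theorems.PrintCFram.BorelKolyvaginPairing
  Literature.NumberTheory.EllipticCurves.Rank1Residual

variable (W : WeierstrassCurve ℚ) [W.IsElliptic] (p : ℕ) [hp : Fact p.Prime]
variable {K : Type} [Field K] [NumberField K]

omit [W.IsElliptic] hp [NumberField K] in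
/-- **The offset `[x, z^τ z]` is `(−ν)`-eigen.** For a `σ_*`-eigenclass `x` (sign `ν`), an involutive
lift `τ` and `z` acting on `E[n]` as `−1`: `τ[x, z^τz] = −ν[x, z^τz]` (`(z^τz)^τ = z z^τ = z (z^τz) z⁻¹`
and `z` acts as `−1` on the value). [folklore] -/
theorem torsionMap_h1Eval_conjGalCMH_mul_of_smul_eq_neg {k : Type v} [Field k] [Algebra k K]
    (V : WeierstrassCurve k) {σ : K ≃ₐ[k] K} {τ : AlgebraicClosure K ≃+* AlgebraicClosure K}
    (hτ : IsLiftOfAut σ τ) (hinv : ∀ x, τ (τ x) = x) (n : ℤ)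
    {x : galH1Torsion (V.baseChange K) n} {ν : ℤ} (hν : ν = 1 ∨ ν = -1)
    (hx : conjAct V σ n x = ν • x) {z : absoluteGaloisGroup K}
    (hz : ∀ P : geomTorsion (V.baseChange K) n, z • P = -P) :
    hτ.torsionMap V n (h1Eval (V.baseChange K) n x (hτ.conjGalCMH z * z)) =
      -(ν • h1Eval (V.baseChange K) n x (hτ.conjGalCMH z * z)) := by
  have hzz := conjGalCMH_mul_mem_torsionFixing_of_smul_eq_neg V hτ hinv n hz
  have h1 := hτ.h1Eval_conjGalCMH_of_eigen V hinv n hν hx hzz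
  -- `(z^τ z)^τ = z · z^τ = z (z^τ z) z⁻¹`
  have heq : hτ.conjGalCMH (hτ.conjGalCMH z * z) = z * (hτ.conjGalCMH z * z) * z⁻¹ := by
    rw [map_mul, hτ.conjGalCMH_conjGalCMH hinv]; group
  rw [heq, h1Eval_conj _ n x z hzz, hz] at h1
  -- `h1 : -[x, z^τz] = ν • τ[x, z^τz]`
  have hνν : ν * ν = 1 := by rcases hν with rfl | rfl <;> norm_num
  have h2 := congrArg (fun w ↦ ν • w) h1
  simp only [smul_smul, hνν, one_smul, smul_neg] at h2
  exact h2.symm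

/-- **FILE 7″ — the Borel `cebotarev` REQUESTS at a prime of the SECOND Frobenius type: the sign rule
of FILE 7′ (`…BorelRequestsCebotarev.exists_kolyvaginPrime_gt_pow_requests_of_cmRamified`) SWAPPED.**
`W` CM, `5 ≤ p` CM-ramified, `𝓞_𝔭`-structure `(s, μ, m)`; `K` imaginary quadratic with complex
conjugation `c` lifted along `c₀`; `η = ±1` the sign of `c₀` on `ker μ`; `M ≥ 1`; `c_*`-eigenclasses
`x_i` (signs `ν_i = ±1`) with values killed by `μ^{e_i}` and independent top layers (as in FILE 7′);
SOME `z ∈ Γ_K` acting on `W[p^M]` as `−1`; exponents `N_i` with, for each `i`: `N_i = 0`, or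
**`ν_i = −η` and `2N_i ≤ e_i + 1`** (any order up to `ord = p^{⌈e_i/2⌉}` — the classes FILE 7′ caps at
`p^{⌊e_i/2⌋}`, in particular the BLIND depth-one `(−η)`-classes), or **`ν_i = η` and `2N_i ≤ e_i`**.
Then above every `b` there is a prime `ℓ`, `ℓ ∤ N·d_K`, `ℓ ≠ p`, `(ℓ)` prime in `𝓞 K`, `p^M ∣ ℓ + 1`,
`p^M ∣ a_ℓ` (good reduction), Frobenius `= −c₀` on `W(ℚ̄)[p^M]` and `= c₀` on `K`, with
**`p^{N_i} x_i ∈ ker loc_λ` and `N_i ≠ 0 → p^{N_i−1} x_i ∉ ker loc_λ`** for every `i` — the conclusion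
shape of `KolyvaginDescent.HypothesesM.cebotarev` without `FrobEqFrobInfty`. Proof: at a type-two prime
the achievable local values of `x_i` are `[x_i, z^τz] + (1 − ν_iτ)[x_i, ρ₀]`, `ρ₀ ∈ Γ_{K(W[p^M])}`, i.e.
the whole `(−ν_i)`-eigenspace of the value layer: pick `(−ν_i)`-eigen `u_i` of exact depth `2N_i − 1` /
`2N_i` (`exists_eigen_exactDepth`), realise the targets `t_i = ½(u_i − [x_i, z^τz])` jointly by `ρ₀`
(McCallum's (2) on the leaf, `exists_h1Eval_eq_pow_of_cmRamified` — arbitrary targets in the layers),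
and run the type-two Čebotarev step with `ρ = zρ₀`. [cite: McCallumLMS1991, §3 Cor. 3.2] -/
theorem exists_prime_gt_pow_requests_typeTwo_of_cmRamified
    (hC : Literature.NumberTheory.Automorphic.chebotarev_artinRep) {N : ℕ} [NeZero N]
    (hCM : W.HasCM) (h5 : 5 ≤ p) (hram : CMRamified W p)
    {s : AlgebraicClosure ℚ} {μ : AddMonoid.End W.geomPoints} {m : ℤ}
    (hs : s ^ 2 = ((-(p : ℤ) : ℤ) : AlgebraicClosure ℚ)) (hm : m.natAbs = p)
    (hμμ : ∀ P, μ (μ P) = m • P)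
    (hcomm : ∀ g : absoluteGaloisGroup ℚ, g • s = s → ∀ P, μ (g • P) = g • μ P)
    (hanti : ∀ g : absoluteGaloisGroup ℚ, g • s = -s → ∀ P, μ (g • P) = -(g • μ P))
    (hK : IsImaginaryQuadratic K) {M : ℕ} (hM : 1 ≤ M) {c : K ≃ₐ[ℚ] K}
    {c₀ : absoluteGaloisGroup ℚ} (hc₀ : IsComplexConjugation (Rat.castHom ℝ) c₀)
    (ht : IsLiftOfAut c (absGaloisTransport (K := ℚ) (L := K) c₀).toRingEquiv)
    {η : ℤ} (hηs : η = 1 ∨ η = -1) (hη : ∀ P : W.geomPoints, μ P = 0 → c₀ • P = η • P)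
    {ι : Type*} [Fintype ι] (xs : ι → galH1Torsion (W.baseChange K) ((p ^ M : ℕ) : ℤ))
    {ν : ι → ℤ} (hνs : ∀ i, ν i = 1 ∨ ν i = -1)
    (hxs : ∀ i, conjAct W c ((p ^ M : ℕ) : ℤ) (xs i) = ν i • xs i) (e : ι → ℕ)
    (he : ∀ i, ∀ ρ ∈ torsionFixing (W.baseChange K) ((p ^ M : ℕ) : ℤ),
      (μ ^ e i) ((RatClosure.torsionEquiv (K := K) W ((p ^ M : ℕ) : ℤ)).symm
        (h1Eval (W.baseChange K) ((p ^ M : ℕ) : ℤ) (xs i) ρ) : W.geomPoints) = 0)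
    (hind : ∀ c : ι → ℤ,
      (∀ ρ ∈ torsionFixing (W.baseChange K) ((p ^ M : ℕ) : ℤ),
        ∑ i, c i • (μ ^ (e i - 1)) ((RatClosure.torsionEquiv (K := K) W ((p ^ M : ℕ) : ℤ)).symm
          (h1Eval (W.baseChange K) ((p ^ M : ℕ) : ℤ) (xs i) ρ) : W.geomPoints) = 0) →
        ∀ i, 0 < e i → (p : ℤ) ∣ c i)
    {z : absoluteGaloisGroup K} (hz : ∀ P : geomTorsion (W.baseChange K) ((p ^ M : ℕ) : ℤ), z • P = -P)
    (Nv : ι → ℕ)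
    (hreq : ∀ i, Nv i = 0 ∨ (ν i = -η ∧ 2 * Nv i ≤ e i + 1) ∨ (ν i = η ∧ 2 * Nv i ≤ e i)) (b : ℕ) :
    ∃ ℓ : ℕ, b < ℓ ∧ ℓ.Prime ∧ ¬ ℓ ∣ N ∧ ¬ ((ℓ : ℤ) ∣ NumberField.discr K) ∧ ℓ ≠ p ∧
      (Ideal.span {(ℓ : 𝓞 K)}).IsPrime ∧ p ^ M ∣ ℓ + 1 ∧
      (∀ v : HeightOneSpectrum (𝓞 ℚ), (ℓ : 𝓞 ℚ) ∈ v.asIdeal → W.HasGoodReductionAt v →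
        ((p : ℤ) ^ M) ∣ W.frobeniusTraceAt v) ∧
      (∃ (v : HeightOneSpectrum (𝓞 ℚ)) (𝔓₀ : Ideal (absIntegers (𝓞 ℚ) ℚ))
          (h : absoluteGaloisGroup ℚ),
        (ℓ : 𝓞 ℚ) ∈ v.asIdeal ∧ 𝔓₀ ∈ v.primesAbove ∧ IsArithFrobAt (𝓞 ℚ) h 𝔓₀ ∧
          (∀ P : geomTorsion W ((p ^ M : ℕ) : ℤ), h • P = -(c₀ • P)) ∧
          ∀ (emb : K →ₐ[ℚ] AlgebraicClosure ℚ) (y : K), h • emb y = c₀ • emb y) ∧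
      ∀ i, ∀ v : HeightOneSpectrum (𝓞 K), (ℓ : 𝓞 K) ∈ v.asIdeal →
        ((p : ℤ) ^ Nv i) • xs i ∈
            (W.baseChange K).torsionLocalKer (v.adicCompletion K) ((p ^ M : ℕ) : ℤ) ∧
          (Nv i ≠ 0 → ((p : ℤ) ^ (Nv i - 1)) • xs i ∉
            (W.baseChange K).torsionLocalKer (v.adicCompletion K) ((p ^ M : ℕ) : ℤ)) := by
  have hpr : p.Prime := hp.out
  have hp2 : p ≠ 2 := by omega
  haveI : Algebra.IsQuadraticExtension ℚ K := ⟨hK.1⟩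
  have hKp : Module.finrank ℚ K < p := by rw [hK.1]; omega
  have hinv : ∀ y, (absGaloisTransport (K := ℚ) (L := K) c₀).toRingEquiv
      ((absGaloisTransport (K := ℚ) (L := K) c₀).toRingEquiv y) = y := fun y ↦
    RatClosure.absGaloisTransport_absGaloisTransport_of_sq_eq_one hc₀.sq_eq_one y
  -- the offsets `w_i = [x_i, z^τ z]`: values of `x_i`, `(−ν_i)`-eigen
  have hzz : ht.conjGalCMH z * z ∈ torsionFixing (W.baseChange K) ((p ^ M : ℕ) : ℤ) :=
    conjGalCMH_mul_mem_torsionFixing_of_smul_eq_neg W ht hinv _ hz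
  have hwτ : ∀ i, ht.torsionMap W ((p ^ M : ℕ) : ℤ)
      (h1Eval (W.baseChange K) ((p ^ M : ℕ) : ℤ) (xs i) (ht.conjGalCMH z * z)) =
      -(ν i • h1Eval (W.baseChange K) ((p ^ M : ℕ) : ℤ) (xs i) (ht.conjGalCMH z * z)) := fun i ↦
    torsionMap_h1Eval_conjGalCMH_mul_of_smul_eq_neg W ht hinv _ (hνs i) (hxs i) hz
  -- `2` is invertible on `W(K̄)[p^M]`
  obtain ⟨h2, hh2⟩ := exists_two_mul_zsmul_eq_of_odd (W.baseChange K) (hpr.odd_of_ne_two hp2).pow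
  -- a top value for each class with `e i > 0`
  have htop : ∀ i, 0 < e i → ∃ ρ ∈ torsionFixing (W.baseChange K) ((p ^ M : ℕ) : ℤ),
      (μ ^ (e i - 1)) (((RatClosure.torsionEquiv (K := K) W ((p ^ M : ℕ) : ℤ)).symm
        (h1Eval (W.baseChange K) ((p ^ M : ℕ) : ℤ) (xs i) ρ)) : W.geomPoints) ≠ 0 := by
    intro i hei
    by_contra hall
    push Not at hall
    have h1 := hind (Pi.single i 1) (fun ρ hρ ↦ by
      rw [Finset.sum_eq_single i (fun j _ hj ↦ by rw [Pi.single_eq_of_ne hj, zero_smul])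
        (fun h ↦ absurd (Finset.mem_univ i) h), Pi.single_eq_same, one_smul]
      exact hall ρ hρ) i hei
    rw [Pi.single_eq_same] at h1
    exact hpr.one_lt.ne' (by exact_mod_cast Int.eq_one_of_dvd_one (Int.natCast_nonneg p) h1)
  -- the desired LOCAL VALUES `U_i`: `0` where `N_i = 0`, else a `(−ν_i)`-eigenvector of exact depth
  -- `d_i` with `⌈d_i/2⌉ = N_i` (`d_i = 2N_i − 1` for `ν_i = −η`, `d_i = 2N_i` for `ν_i = η`)
  have htarget : ∀ i, ∃ U : geomTorsion (W.baseChange K) ((p ^ M : ℕ) : ℤ),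
      (μ ^ e i) (((RatClosure.torsionEquiv (K := K) W ((p ^ M : ℕ) : ℤ)).symm U :
        W.geomTorsion ((p ^ M : ℕ) : ℤ)) : W.geomPoints) = 0 ∧
      ht.torsionMap W ((p ^ M : ℕ) : ℤ) U = -(ν i • U) ∧
      ∀ a : ℕ, ((p : ℤ) ^ a) • U = 0 ↔ Nv i ≤ a := by
    intro i
    by_cases hNi : Nv i = 0
    · refine ⟨0, by rw [map_zero, ZeroMemClass.coe_zero, map_zero], by
        rw [map_zero, smul_zero, neg_zero], fun a ↦ ?_⟩
      rw [smul_zero, hNi]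
      exact ⟨fun _ ↦ Nat.zero_le a, fun _ ↦ rfl⟩
    have hcase : (ν i = -η ∧ 2 * Nv i ≤ e i + 1) ∨ (ν i = η ∧ 2 * Nv i ≤ e i) := by
      rcases hreq i with h | h | h
      · exact absurd h hNi
      · exact Or.inl h
      · exact Or.inr h
    set d : ℕ := if ν i = -η then 2 * Nv i - 1 else 2 * Nv i with hd
    have hηη : η ≠ -η := by
      rcases hηs with rfl | rfl <;> decide
    have hd1 : 1 ≤ d := by
      rw [hd]; split_ifs <;> omega
    have hde : d ≤ e i := by
      rw [hd]; split_ifs with h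
      · rcases hcase with h' | h'
        · omega
        · exact absurd (h'.1 ▸ h : η = -η) hηη
      · rcases hcase with h' | h'
        · exact absurd h'.1 h
        · omega
    have hpar : (-1 : ℤ) ^ (d - 1) * η = -ν i := by
      rw [hd]; split_ifs with h
      · rw [h, neg_neg, show 2 * Nv i - 1 - 1 = 2 * (Nv i - 1) by omega, pow_mul, neg_one_sq, one_pow,
          one_mul]
      · have hν' : ν i = η := by
          rcases hcase with h' | h'
          · exact absurd h'.1 h
          · exact h'.1
        rw [hν', show 2 * Nv i - 1 = 2 * (Nv i - 1) + 1 by omega, pow_succ, pow_mul, neg_one_sq, one_pow,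
          one_mul, neg_one_mul]
    have hdN : ∀ a : ℕ, d ≤ 2 * a ↔ Nv i ≤ a := by
      intro a; rw [hd]; split_ifs <;> omega
    have hei : 0 < e i := by omega
    obtain ⟨ρ₁, hρ₁, hρ₁top⟩ := htop i hei
    set X : W.geomPoints := (((RatClosure.torsionEquiv (K := K) W ((p ^ M : ℕ) : ℤ)).symm
      (h1Eval (W.baseChange K) ((p ^ M : ℕ) : ℤ) (xs i) ρ₁)) : W.geomPoints) with hX
    have hX_M : X ∈ W.geomTorsion ((p ^ M : ℕ) : ℤ) :=
      ((RatClosure.torsionEquiv (K := K) W ((p ^ M : ℕ) : ℤ)).symm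
        (h1Eval (W.baseChange K) ((p ^ M : ℕ) : ℤ) (xs i) ρ₁)).2
    have ht₀M : (μ ^ (e i - d)) X ∈ W.geomTorsion ((p ^ M : ℕ) : ℤ) :=
      pow_apply_mem_geomTorsion W _ hX_M
    have ht₀d : (μ ^ d) ((μ ^ (e i - d)) X) = 0 := by
      change (μ ^ d * μ ^ (e i - d)) X = 0
      rw [← pow_add, show d + (e i - d) = e i by omega]
      exact he i _ hρ₁
    have ht₀d' : (μ ^ (d - 1)) ((μ ^ (e i - d)) X) ≠ 0 := by
      change (μ ^ (d - 1) * μ ^ (e i - d)) X ≠ 0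
      rw [← pow_add, show d - 1 + (e i - d) = e i - 1 by omega]
      exact hρ₁top
    obtain ⟨t, htM, hteig, htd, htd'⟩ := exists_eigen_exactDepth W p hc₀ hs hanti hp2 hηs hη hd1
      ht₀M ht₀d ht₀d'
    have hteig' : c₀ • t = (-ν i) • t := by rw [hteig, hpar]
    refine ⟨(RatClosure.torsionEquiv (K := K) W ((p ^ M : ℕ) : ℤ)) ⟨t, htM⟩, ?_, ?_, fun a ↦ ?_⟩
    · rw [(RatClosure.torsionEquiv (K := K) W ((p ^ M : ℕ) : ℤ)).symm_apply_apply]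
      exact (pow_apply_eq_zero_iff_le W htd (Or.inr htd') (e i)).mpr hde
    · rw [← neg_smul,
        ← RatClosure.torsionEquiv_smul_of_lift W ht c₀ (fun _ ↦ rfl) ((p ^ M : ℕ) : ℤ) ⟨t, htM⟩,
        ← map_zsmul]
      congr 1
      exact Subtype.ext (by
        change c₀ • t = (((-ν i) • (⟨t, htM⟩ : W.geomTorsion ((p ^ M : ℕ) : ℤ)) :
          W.geomTorsion ((p ^ M : ℕ) : ℤ)) : W.geomPoints)
        rw [AddSubgroupClass.coe_zsmul]; exact hteig')
    · rw [← map_zsmul, AddEquiv.map_eq_zero_iff,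
        show (((p : ℤ) ^ a) • (⟨t, htM⟩ : W.geomTorsion ((p ^ M : ℕ) : ℤ)) = 0) ↔
          ((p : ℤ) ^ a) • t = 0 from
          ⟨fun h ↦ by
              have h' := congrArg Subtype.val h
              rw [AddSubgroupClass.coe_zsmul, ZeroMemClass.coe_zero] at h'
              exact h',
            fun h ↦ Subtype.ext (by rw [AddSubgroupClass.coe_zsmul, ZeroMemClass.coe_zero]; exact h)⟩,
        pow_zsmul_eq_zero_iff_le_two_mul W p hm hμμ htd (Or.inr htd') a]
      exact hdN a
  choose U hUe hUτ hUord using htarget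
  -- the TARGETS `t_i = ½ (U_i − w_i)` for `[x_i, ρ₀]`
  set tg : ι → geomTorsion (W.baseChange K) ((p ^ M : ℕ) : ℤ) := fun i ↦
    h2 • (U i - h1Eval (W.baseChange K) ((p ^ M : ℕ) : ℤ) (xs i) (ht.conjGalCMH z * z)) with htg
  have htge : ∀ i, (μ ^ e i) (((RatClosure.torsionEquiv (K := K) W ((p ^ M : ℕ) : ℤ)).symm (tg i) :
      W.geomTorsion ((p ^ M : ℕ) : ℤ)) : W.geomPoints) = 0 := by
    intro i
    simp only [htg, map_zsmul, map_sub, AddSubgroupClass.coe_zsmul, AddSubgroupClass.coe_sub, hUe,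
      he i _ hzz, sub_self, smul_zero]
  obtain ⟨ρ₀, hρ₀T, hρ₀t⟩ := exists_h1Eval_eq_pow_of_cmRamified W p K hCM h5 hram hs hm hμμ hcomm hKp
    hM xs e he hind tg htge
  -- `ρ = z ρ₀` acts as `−1`
  have hρ : ∀ P : geomTorsion (W.baseChange K) ((p ^ M : ℕ) : ℤ), (z * ρ₀) • P = -P :=
    smul_eq_neg_mul_of_mem_torsionFixing W _ hz hρ₀T
  have hρ2 := conjGalCMH_mul_mem_torsionFixing_of_smul_eq_neg W ht hinv _ hρ
  -- §2: the prime
  obtain ⟨ℓ, hbℓ, hℓ, hℓN, hℓD, hℓp, hprime, m', hm', ⟨v, 𝔓₀, hℓv, h𝔓₀, hfrob⟩, hloc⟩ :=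
    exists_prime_gt_of_galoisElement_of_conjGalCMH_mul_mem (N := N) hC hK hpr hc₀ ht hinv xs hρ2 b
  have hE : ∀ P : geomTorsion W ((p ^ M : ℕ) : ℤ),
      (c₀ * absGaloisRestrict ℚ K (z * ρ₀ * m')) • P = -(c₀ • P) :=
    mul_absGaloisRestrict_smul_eq_neg W c₀ hρ hm'.1
  have hgT : ht.conjGalCMH (z * ρ₀ * m') * (z * ρ₀ * m') ∈
      torsionFixing (W.baseChange K) ((p ^ M : ℕ) : ℤ) :=
    conjGalCMH_mul_mul_mem_torsionFixing W ht hinv _ hρ2 hm'.1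
  -- the local value of `x_i` is `U_i`
  have hval : ∀ i, h1Eval (W.baseChange K) ((p ^ M : ℕ) : ℤ) (xs i)
      (ht.conjGalCMH (z * ρ₀ * m') * (z * ρ₀ * m')) = U i := by
    intro i
    have hρ₀m : ρ₀ * m' ∈ torsionFixing (W.baseChange K) ((p ^ M : ℕ) : ℤ) := mul_mem hρ₀T hm'.1
    have hνν : ν i * ν i = 1 := by rcases hνs i with h | h <;> rw [h] <;> norm_num
    rw [mul_assoc z ρ₀ m',
      h1Eval_conjGalCMH_mul_mul_of_smul_eq_neg W ht hinv _ (hνs i) (hxs i) hz hρ₀m,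
      h1Eval_mul _ _ (xs i) hρ₀T, hρ₀t i, hm'.2 i, add_zero]
    -- `τ (tg i) = −ν_i • tg i`
    have hτt : ht.torsionMap W ((p ^ M : ℕ) : ℤ) (tg i) = -(ν i • tg i) := by
      simp only [htg, map_zsmul, map_sub, hUτ, hwτ]
      module
    rw [hτt, smul_neg, smul_smul, hνν, one_smul, sub_neg_eq_add]
    have htt : tg i + tg i = U i - h1Eval (W.baseChange K) ((p ^ M : ℕ) : ℤ) (xs i)
        (ht.conjGalCMH z * z) := by
      rw [← two_zsmul, htg, smul_smul, hh2]
    rw [htt]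
    abel
  refine ⟨ℓ, hbℓ, hℓ, hℓN, hℓD, hℓp, hprime,
    pow_dvd_add_one_of_smul_eq_neg W hpr hM hℓ hℓp hℓv h𝔓₀ hfrob hc₀ hE,
    fun v' hv' hgood ↦ ?_, ⟨v, 𝔓₀, _, hℓv, h𝔓₀, hfrob, hE, fun emb y ↦ ?_⟩, fun i v' hv' ↦ ?_⟩
  · have hvv : v' = v := HeightOneSpectrum.eq_of_natCast_mem_rat hℓ hv' hℓv
    subst hvv
    exact pow_dvd_frobeniusTraceAt_of_smul_eq_neg W hpr hM hℓ hℓp hℓv h𝔓₀ hfrob hc₀ hE hgood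
  · rw [mul_smul, absGaloisRestrict_smul_apply_eq (z * ρ₀ * m') emb y]
  · have hmem : ∀ a : ℕ, ((p : ℤ) ^ a) • xs i ∈ AddSubgroup.closure (Set.range xs) := fun a ↦
      AddSubgroup.zsmul_mem _ (AddSubgroup.subset_closure (Set.mem_range_self i)) _
    have hkey : ∀ a : ℕ, ((p : ℤ) ^ a) • xs i ∈
        (W.baseChange K).torsionLocalKer (v'.adicCompletion K) ((p ^ M : ℕ) : ℤ) ↔ Nv i ≤ a := by
      intro a
      rw [hloc _ (hmem a) v' hv', h1Eval_zsmul _ _ _ _ hgT, hval i, hUord]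
    exact ⟨(hkey _).mpr le_rfl, fun hNi h ↦ by have := (hkey _).mp h; omega⟩

end Requests

end Summit.BirchSwinnertonDyer.BirchSwinnertonDyer.Theorems.PrintCFram.BorelTypeTwo

end
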